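import Literature.Probability.Percolation.SelfRefinementMeasure
import Literature.Probability.Percolation.KohlerSchindlerTassionRSW
import Summits.CriticalPhenomena.CardyFormulaZ2.Theorems.CardySelfRefinementCriticalPathRSWStubCone3LargeA
import Summits.CriticalPhenomena.CardyFormulaZ2.Theorems.CardySelfRefinementCriticalPathRSWStubCone3PivotB

/-!
# Stub `stub_cone3` of line `finite-size-envelope` (crux `CriticalPathRSW`), part 15:
small interior density (`c ≤ 1/10`) I — the two-sided event and the chain events

Support file for item `stmt-CriticalPhenomena-10267` (stub `stub_cone3`).  For the tuple `(b, d)`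
in the box `[-3n, 3n] × [-9n, 9n]` with interior vertices off the two sides, let `F` be the four
interior labels at the interior vertices and `C₂ = Z⟪T ∪ F, T⟫ \ Z⟪T ∪ F, ∅⟫` the event that, with
`F` closed, the whole tuple is pivotal (the *two-sided* event).  This part proves:

* `C₂` is measurable and does not read the own coins of `F` (`Cone3.determinedBy_C2`);
* off `C₂`, a configuration for which the closed tuple is pivotal lies in one of the `16 · 4`
  chain events `Z⟪{f} ∪ S₁, {f} ∪ T⟫ \ Z⟪{f} ∪ S₁, ∅ ∪ T⟫`, `S₁ ⊆ F`, `f ∈ F`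
  (`Cone3.pivotal_diff_C2_subset`, from the chain case of part 6);
* hence `P((Z⟪T, T⟫ \ Z⟪T, ∅⟫) \ C₂) ≤ 832 · Σ_{g ∈ Π} P(g pivotal)` for `c ≤ 1/10`
  (`Cone3.real_pivotal_diff_C2_le`, from the chain event bound of part 10).

References: Aizenman–Grimmett 1991 §3; Grimmett 1999 §2.4.
-/

noncomputable section

namespace Summit.CriticalPhenomena.CardyFormulaZ2.Cruxes.CriticalPathRSW.FiniteSizeEnvelope

open Set MeasureTheory
open Literature.Probability.LatticeModels Literature.Probability.Percolation

namespace Cone3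

variable {n : ℕ} {ρ c : ℝ} {b : Site 2} {d d' : Fin 2}

set_option quotPrecheck false

/-- The local frame of the tuple `(b, d)`: `pt⟪α, β⟫ = 3b + α e_d + β e_{d'}`. -/
local notation "pt⟪" α ", " β "⟫" =>
  ((3 : ℤ) • b + (α : ℤ) • (Pi.single d (1 : ℤ) : Site 2) + (β : ℤ) • (Pi.single d' (1 : ℤ) : Site 2))

/-- The open labels of a coin configuration. -/
local notation "Op⟪" S "⟫" => {e : Site 2 × Fin 2 | RefinementOpen 3 S e}

/-- Crossing of the box by a label configuration. -/
local notation "Cr⟪" V "⟫" => (edgeConfig V ∈ KST2023.crossing (3 * n) (3 * (3 * n)))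

/-- The override event: close `C`, open `A`, and ask for a left-right crossing of the box. -/
local notation "Z⟪" C ", " A "⟫" =>
  {S : Set (Site 2 × Fin 2 × Fin 3) |
    edgeConfig ((Op⟪S⟫ \ C) ∪ A) ∈ KST2023.crossing (3 * n) (3 * (3 * n))}

/-- The three sub-edges of the tuple. -/
local notation "Tl" =>
  ({(pt⟪0, 0⟫, d), (pt⟪1, 0⟫, d), (pt⟪2, 0⟫, d)} : Set (Site 2 × Fin 2))

/-- The box. -/
local notation "Bx" => (KST2023.box (3 * n) (3 * (3 * n)))

/-- Its left side. -/
local notation "Lx" => {x : Site 2 | x ∈ KST2023.box (3 * n) (3 * (3 * n)) ∧ x 0 = -((3 * n : ℕ) : ℤ)}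

/-- Its right side. -/
local notation "Rx" => {x : Site 2 | x ∈ KST2023.box (3 * n) (3 * (3 * n)) ∧ x 0 = ((3 * n : ℕ) : ℤ)}

/-- The four interior labels at the interior vertices of the tuple. -/
local notation "Fl" =>
  ({(pt⟪1, 0⟫, d'), (pt⟪1, -1⟫, d'), (pt⟪2, 0⟫, d'), (pt⟪2, -1⟫, d')} : Set (Site 2 × Fin 2))

/-- The same four labels, as a `Finset`. -/
local notation "Flf" =>
  ({(pt⟪1, 0⟫, d'), (pt⟪1, -1⟫, d'), (pt⟪2, 0⟫, d'), (pt⟪2, -1⟫, d')} : Finset (Site 2 × Fin 2))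

/-- Their four own coins. -/
local notation "Fc" =>
  ({(pt⟪1, 0⟫, d', (0 : Fin 3)), (pt⟪1, -1⟫, d', (0 : Fin 3)), (pt⟪2, 0⟫, d', (0 : Fin 3)),
    (pt⟪2, -1⟫, d', (0 : Fin 3))} : Finset (Site 2 × Fin 2 × Fin 3))

/-- Pivotality of the own coin of the interior label `g`. -/
local notation "Piv⟪" g "⟫" =>
  ({S : Set (Site 2 × Fin 2 × Fin 3) |
      edgeConfig ((Op⟪S⟫ \ {g}) ∪ {g}) ∈ KST2023.crossing (3 * n) (3 * (3 * n))} \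
    {S : Set (Site 2 × Fin 2 × Fin 3) |
      edgeConfig ((Op⟪S⟫ \ {g}) ∪ ∅) ∈ KST2023.crossing (3 * n) (3 * (3 * n))})

/-- The chain event of `(S₁, f)`: `S₁ ∪ {f}` closed, tuple open, `f` pivotal. -/
local notation "Ech⟪" S₁ ", " f "⟫" => (Z⟪{f} ∪ ↑S₁, {f} ∪ Tl⟫ \ Z⟪{f} ∪ ↑S₁, ∅ ∪ Tl⟫)

/-- The two-sided event: with `F` closed the whole tuple is pivotal. -/
local notation "C2" => (Z⟪Tl ∪ Fl, Tl⟫ \ Z⟪Tl ∪ Fl, (∅ : Set (Site 2 × Fin 2))⟫)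

/-- The eighteen interior labels next to the tuple used by the walks. -/
local notation "Πf" =>
  ({(pt⟪0, 1⟫, d), (pt⟪1, 0⟫, d'), (pt⟪-1, 0⟫, d'), (pt⟪-1, 1⟫, d), (pt⟪2, 1⟫, d), (pt⟪2, 0⟫, d'),
    (pt⟪4, 0⟫, d'), (pt⟪3, 1⟫, d), (pt⟪1, 1⟫, d),
    (pt⟪0, -1⟫, d), (pt⟪1, -1⟫, d'), (pt⟪-1, -1⟫, d'), (pt⟪-1, -1⟫, d), (pt⟪2, -1⟫, d), (pt⟪2, -1⟫, d'),
    (pt⟪4, -1⟫, d'), (pt⟪3, -1⟫, d), (pt⟪1, -1⟫, d)} : Finset (Site 2 × Fin 2))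

/-- The coin law. -/
local notation "P" => (prodBernoulli (refinementParam 3 ρ c))

/-! ### The labels of `F` -/

/-- The labels of `F` are interior. -/
theorem not_axial_of_mem_Fl (hd : d' ≠ d) {ℓ : Site 2 × Fin 2} (hℓ : ℓ ∈ Fl) : ¬ IsAxialEdge 3 ℓ := by
  have h1 : ¬ (3 : ℤ) ∣ 1 := by decide
  have h2 : ¬ (3 : ℤ) ∣ 2 := by decide
  simp only [Set.mem_insert_iff, Set.mem_singleton_iff] at hℓ
  rcases hℓ with rfl | rfl | rfl | rfl
  · exact not_axial_d' hd 0 h1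
  · exact not_axial_d' hd (-1) h1
  · exact not_axial_d' hd 0 h2
  · exact not_axial_d' hd (-1) h2

/-- `↑Flf = Fl`. -/
theorem coe_Flf_eq : (↑Flf : Set (Site 2 × Fin 2)) = Fl := by
  simp only [Finset.coe_insert, Finset.coe_singleton]

/-- The labels of `F` are in `Π`. -/
theorem mem_Pi_of_mem_Flf {ℓ : Site 2 × Fin 2} (hℓ : ℓ ∈ Flf) : ℓ ∈ Πf := by
  simp only [Finset.mem_insert, Finset.mem_singleton] at hℓ
  rcases hℓ with rfl | rfl | rfl | rfl <;> simp only [Finset.mem_insert, Finset.mem_singleton, true_or, or_true]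

/-- The own coins of `F` are the coins of `Fc`. -/
theorem own_mem_Fc {ℓ : Site 2 × Fin 2} (hℓ : ℓ ∈ Fl) : (ℓ.1, ℓ.2, (0 : Fin 3)) ∈ Fc := by
  simp only [Set.mem_insert_iff, Set.mem_singleton_iff] at hℓ
  rcases hℓ with rfl | rfl | rfl | rfl <;> simp

/-- The coins of `Fc` are own coins of labels of `F`. -/
theorem mem_Fc_iff {i : Site 2 × Fin 2 × Fin 3} :
    i ∈ Fc ↔ ∃ ℓ ∈ Fl, i = (ℓ.1, ℓ.2, (0 : Fin 3)) := by
  constructor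
  · intro hi
    simp only [Finset.mem_insert, Finset.mem_singleton] at hi
    rcases hi with rfl | rfl | rfl | rfl
    · exact ⟨(pt⟪1, 0⟫, d'), by simp, rfl⟩
    · exact ⟨(pt⟪1, -1⟫, d'), by simp, rfl⟩
    · exact ⟨(pt⟪2, 0⟫, d'), by simp, rfl⟩
    · exact ⟨(pt⟪2, -1⟫, d'), by simp, rfl⟩
  · rintro ⟨ℓ, hℓ, rfl⟩
    exact own_mem_Fc hℓ

/-! ### The two-sided event -/

/-- `C₂` is measurable. -/
theorem measurableSet_C2 : MeasurableSet C2 := (measurableSet_Z _ _).diff (measurableSet_Z _ _)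

/-- `C₂` does not read the own coins of `F`. -/
theorem determinedBy_C2 (hd : d' ≠ d) : DeterminedBy C2 (↑Fc : Set (Site 2 × Fin 2 × Fin 3))ᶜ := by
  have hK : (↑Fc : Set (Site 2 × Fin 2 × Fin 3)) ⊆ {(b, d, (2 : Fin 3)), (b, d, (1 : Fin 3)),
      (pt⟪0, 0⟫, d, (0 : Fin 3)), (pt⟪1, 0⟫, d, (0 : Fin 3)), (pt⟪2, 0⟫, d, (0 : Fin 3))} ∪
        (fun ℓ : Site 2 × Fin 2 => (ℓ.1, ℓ.2, (0 : Fin 3))) '' Fl := by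
    intro i hi
    obtain ⟨ℓ, hℓ, rfl⟩ := mem_Fc_iff.1 (Finset.mem_coe.1 hi)
    exact Or.inr ⟨ℓ, hℓ, rfl⟩
  have hC : ∀ A : Set (Site 2 × Fin 2), ∀ e : Site 2 × Fin 2,
      (e = (pt⟪0, 0⟫, d) ∨ e = (pt⟪1, 0⟫, d) ∨ e = (pt⟪2, 0⟫, d) ∨ e ∈ Fl) → e ∈ (Tl ∪ Fl) ∪ A := by
    intro A e he
    rcases he with rfl | rfl | rfl | he
    · exact Or.inl (Or.inl (by simp))
    · exact Or.inl (Or.inl (by simp))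
    · exact Or.inl (Or.inl (by simp))
    · exact Or.inl (Or.inr he)
  exact determinedBy_sdiff (determinedBy_Z hd hK (hC _)) (determinedBy_Z hd hK (hC _))

/-- On the cylinder "`F` closed", `Op⟪S⟫ \ T = Op⟪S⟫ \ (T ∪ F)`. -/
theorem op_diff_eq_of_cylF (hd : d' ≠ d) {S : Set (Site 2 × Fin 2 × Fin 3)}
    (hS : S ∈ localCylinder (↑Fc : Set (Site 2 × Fin 2 × Fin 3)) ∅) : Op⟪S⟫ \ Tl = Op⟪S⟫ \ (Tl ∪ Fl) := by
  ext e
  simp only [Set.mem_sdiff, Set.mem_setOf_eq, Set.mem_union, not_or]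
  constructor
  · rintro ⟨he, heT⟩
    refine ⟨he, heT, fun heF => ?_⟩
    rw [refinementOpen_iff_of_not_axial (not_axial_of_mem_Fl hd heF)] at he
    exact (hS _ (Finset.mem_coe.2 (own_mem_Fc heF))).1 he
  · rintro ⟨he, heT, -⟩
    exact ⟨he, heT⟩

/-! ### Off the two-sided event: the chain events -/

/-- A chain conclusion places the configuration in the chain event of `(S₁, f)`. -/
theorem mem_chainEvent {S : Set (Site 2 × Fin 2 × Fin 3)} {S₁ : Finset (Site 2 × Fin 2)} {f : Site 2 × Fin 2}
    (h1 : Cr⟪(Op⟪S⟫ \ Tl) \ (Tl ∪ ↑S₁ ∪ {f}) ∪ (Tl ∪ {f})⟫)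
    (h2 : ¬ Cr⟪(Op⟪S⟫ \ Tl) \ (Tl ∪ ↑S₁ ∪ {f}) ∪ Tl⟫) : S ∈ Ech⟪S₁, f⟫ := by
  have heq : (Op⟪S⟫ \ Tl) \ (Tl ∪ ↑S₁ ∪ {f}) = Op⟪S⟫ \ (Tl ∪ ↑S₁ ∪ {f}) := by
    ext e
    simp only [Set.mem_sdiff, Set.mem_union, Set.mem_setOf_eq, not_or]
    tauto
  rw [heq] at h1 h2
  exact chain_event_subset (n := n) (↑S₁) f ⟨h1, h2⟩

/-- **Off `C₂` the chain case applies.** -/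
theorem pivotal_diff_C2_subset (hd : d' ≠ d) (hbox : ∀ j : ℤ, 0 ≤ j → j ≤ 3 → pt⟪j, 0⟫ ∈ Bx)
    (hm1 : pt⟪1, 0⟫ ∉ Lx ∧ pt⟪1, 0⟫ ∉ Rx) (hm2 : pt⟪2, 0⟫ ∉ Lx ∧ pt⟪2, 0⟫ ∉ Rx) :
    (Z⟪Tl, Tl⟫ \ Z⟪Tl, (∅ : Set (Site 2 × Fin 2))⟫) \ C2 ⊆
      ⋃ S₁ ∈ (Flf).powerset, ⋃ f ∈ Flf, Ech⟪S₁, f⟫ := by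
  classical
  rintro S ⟨⟨hyes, hno⟩, hC⟩
  have hu := hbox 0 le_rfl (by norm_num)
  have hw := hbox 3 (by norm_num) le_rfl
  have hno' : ¬ Cr⟪Op⟪S⟫ \ Tl⟫ := by
    intro h; apply hno
    show Cr⟪(Op⟪S⟫ \ Tl) ∪ ∅⟫
    rw [Set.union_empty]; exact h
  have hyes' : Cr⟪(Op⟪S⟫ \ Tl) ∪ Tl⟫ := hyes
  -- not two-sided, since `S ∉ C₂`
  have hV0 : (Op⟪S⟫ \ Tl) \ (Tl ∪ Fl) = Op⟪S⟫ \ (Tl ∪ Fl) := by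
    ext e
    simp only [Set.mem_sdiff, Set.mem_union, Set.mem_setOf_eq, not_or]
    tauto
  have hnoV0 : ¬ Cr⟪Op⟪S⟫ \ (Tl ∪ Fl)⟫ := fun h =>
    hno' (crossing_mono (Set.sdiff_subset_sdiff_right Set.subset_union_left) h)
  have hnot := fun htwo : _ => hC ⟨(crossing_of_twoSided hd (V := Op⟪S⟫ \ (Tl ∪ Fl)) hbox htwo :
      Cr⟪(Op⟪S⟫ \ (Tl ∪ Fl)) ∪ Tl⟫), fun h => hnoV0 (by
        have h' : Cr⟪(Op⟪S⟫ \ (Tl ∪ Fl)) ∪ ∅⟫ := h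
        rwa [Set.union_empty] at h')⟩
  obtain ⟨S₁, hS₁, f, hf, -, h1, h2⟩ :=
    chain_case hd (W := Op⟪S⟫ \ Tl) hu hw hm1 hm2 (by rwa [Set.sdiff_sdiff, Set.union_self] )
      (by rwa [Set.sdiff_sdiff, Set.union_self]) (by rwa [hV0])
  simp only [Set.mem_iUnion, exists_prop]
  refine ⟨S₁, hS₁, f, hf, mem_chainEvent ?_ ?_⟩
  · exact h1
  · exact h2

/-- The cost of a chain event: `P(Ech⟪S₁, f⟫) ≤ 13 · Σ_{g ∈ Π} P(g pivotal)`. -/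
theorem real_chainEvent_le (hd : d' ≠ d) (hρ0 : 0 ≤ ρ) (hρ1 : ρ ≤ 1) (hc0 : 0 ≤ c) (hc : c ≤ 1 / 10)
    {S₁ : Finset (Site 2 × Fin 2)} (hS₁ : S₁ ∈ (Flf).powerset) {f : Site 2 × Fin 2} (hf : f ∈ Flf) :
    (P).real Ech⟪S₁, f⟫ ≤ 13 * ∑ g' ∈ Πf, (P).real Piv⟪g'⟫ := by
  have hc1 : c ≤ 1 := by linarith
  have hS₁F : S₁ ⊆ Flf := Finset.mem_powerset.1 hS₁
  have hS₁' : ∀ ℓ ∈ S₁, ¬ IsAxialEdge 3 ℓ := fun ℓ hℓ =>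
    not_axial_of_mem_Fl hd (by rw [← coe_Flf_eq]; exact Finset.mem_coe.2 (hS₁F hℓ))
  have hf' : ¬ IsAxialEdge 3 f := not_axial_of_mem_Fl hd (by rw [← coe_Flf_eq]; exact Finset.mem_coe.2 hf)
  have h := chain_event_bound (n := n) (b := b) hd hρ0 hρ1 hc0 hc1 hS₁' hf'
  have hcard : S₁.card ≤ 4 := (Finset.card_le_card hS₁F).trans Finset.card_le_four
  have hpow : (6561 / 10000 : ℝ) ≤ (1 - c) ^ S₁.card := by
    calc (6561 / 10000 : ℝ) = (9 / 10) ^ 4 := by norm_num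
      _ ≤ (9 / 10) ^ S₁.card := pow_le_pow_of_le_one (by norm_num) (by norm_num) hcard
      _ ≤ (1 - c) ^ S₁.card := pow_le_pow_left₀ (by norm_num) (by linarith) _
  have hE0 : 0 ≤ (P).real Ech⟪S₁, f⟫ := measureReal_nonneg
  have hPiv : (P).real Piv⟪f⟫ ≤ ∑ g' ∈ Πf, (P).real Piv⟪g'⟫ :=
    Finset.single_le_sum (f := fun g' => (P).real Piv⟪g'⟫) (fun _ _ => measureReal_nonneg) (mem_Pi_of_mem_Flf hf)
  nlinarith [mul_le_mul_of_nonneg_right hpow hE0]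

/-- **Off `C₂`**: `P((Z⟪T, T⟫ \ Z⟪T, ∅⟫) \ C₂) ≤ 832 · Σ_{g ∈ Π} P(g pivotal)`. -/
theorem real_pivotal_diff_C2_le (hd : d' ≠ d) (hρ0 : 0 ≤ ρ) (hρ1 : ρ ≤ 1) (hc0 : 0 ≤ c) (hc : c ≤ 1 / 10)
    (hbox : ∀ j : ℤ, 0 ≤ j → j ≤ 3 → pt⟪j, 0⟫ ∈ Bx)
    (hm1 : pt⟪1, 0⟫ ∉ Lx ∧ pt⟪1, 0⟫ ∉ Rx) (hm2 : pt⟪2, 0⟫ ∉ Lx ∧ pt⟪2, 0⟫ ∉ Rx) :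
    (P).real ((Z⟪Tl, Tl⟫ \ Z⟪Tl, (∅ : Set (Site 2 × Fin 2))⟫) \ C2) ≤ 832 * ∑ g' ∈ Πf, (P).real Piv⟪g'⟫ := by
  set PS := ∑ g' ∈ Πf, (P).real Piv⟪g'⟫ with hPS
  have hPS0 : 0 ≤ PS := Finset.sum_nonneg fun _ _ => measureReal_nonneg
  refine (measureReal_mono (pivotal_diff_C2_subset hd hbox hm1 hm2) (measure_ne_top _ _)).trans ?_
  refine (measureReal_biUnion_finset_le _ _).trans ?_
  have hinner : ∀ S₁ ∈ (Flf).powerset, (P).real (⋃ f ∈ Flf, Ech⟪S₁, f⟫) ≤ 4 * (13 * PS) := by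
    intro S₁ hS₁
    refine (measureReal_biUnion_finset_le _ _).trans ?_
    have hle : ∀ f ∈ Flf, (P).real Ech⟪S₁, f⟫ ≤ 13 * PS := fun f hf =>
      real_chainEvent_le hd hρ0 hρ1 hc0 hc hS₁ hf
    refine (Finset.sum_le_card_nsmul _ _ _ hle).trans ?_
    rw [nsmul_eq_mul]
    have h4 : ((Flf).card : ℝ) ≤ 4 := by exact_mod_cast Finset.card_le_four
    nlinarith
  refine (Finset.sum_le_card_nsmul _ _ _ hinner).trans ?_
  rw [nsmul_eq_mul, Finset.card_powerset]
  have h16 : ((2 ^ (Flf).card : ℕ) : ℝ) ≤ 16 := by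
    have h := (Nat.pow_le_pow_right (by norm_num : 1 ≤ 2) (Finset.card_le_four :
      (Flf).card ≤ 4)).trans (by norm_num : 2 ^ 4 ≤ 16)
    exact_mod_cast h
  nlinarith

end Cone3

/-- **Registered sub-goal `stub_cone3_smallA` of stub `stub_cone3`** (`Cone3.op_diff_eq_of_cylF` with all local notations
expanded). -/
theorem stub_cone3_smallA : ∀ {b : Site 2} {d d' : Fin 2} (hd : d' ≠ d) {S : Set (Site 2 × Fin 2 × Fin 3)} (hS : S ∈ localCylinder (↑(({((((3 : ℤ) • b + ((1) : ℤ) • (Pi.single d (1 : ℤ) : Site 2) + ((0) : ℤ) • (Pi.single d' (1 : ℤ) : Site 2))), d', (0 : Fin 3)), ((((3 : ℤ) • b + ((1) : ℤ) • (Pi.single d (1 : ℤ) : Site 2) + ((-1) : ℤ) • (Pi.single d' (1 : ℤ) : Site 2))), d', (0 : Fin 3)), ((((3 : ℤ) • b + ((2) : ℤ) • (Pi.single d (1 : ℤ) : Site 2) + ((0) : ℤ) • (Pi.single d' (1 : ℤ) : Site 2))), d', (0 : Fin 3)), ((((3 : ℤ) • b + ((2) : ℤ) • (Pi.single d (1 :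 ℤ) : Site 2) + ((-1) : ℤ) • (Pi.single d' (1 : ℤ) : Site 2))), d', (0 : Fin 3))} : Finset (Site 2 × Fin 2 × Fin 3))) : Set (Site 2 × Fin 2 × Fin 3)) ∅), ({e : Site 2 × Fin 2 | RefinementOpen 3 (S) e}) \ (({((((3 : ℤ) • b + ((0) : ℤ) • (Pi.single d (1 : ℤ) : Site 2) + ((0) : ℤ) • (Pi.single d' (1 : ℤ) : Site 2))), d), ((((3 : ℤ) • b + ((1) : ℤ) • (Pi.single d (1 : ℤ) : Site 2) + ((0) : ℤ) • (Pi.single d' (1 : ℤ) : Site 2))), d), ((((3 : ℤ) • b + ((2) : ℤ) • (Pi.single d (1 : ℤ) : Site 2) + ((0) : ℤ) • (Pi.single d' (1 : ℤ) : Site 2))), d)} : Set (Site 2 × Fin 2))) = ({e : Site 2 × Fin 2 | RefinementOpen 3 (S) e}) \ ((({((((3 : ℤ) • b + ((0) : ℤ) • (Pi.single d (1 : ℤ) : Site 2) + ((0) : ℤ) • (Pi.single d' (1 : ℤ) : Site 2))), d), ((((3 : ℤ) • b + ((1) : ℤ) • (Pi.single d (1 : ℤ) : Site 2) + ((0) :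 ℤ) • (Pi.single d' (1 : ℤ) : Site 2))), d), ((((3 : ℤ) • b + ((2) : ℤ) • (Pi.single d (1 : ℤ) : Site 2) + ((0) : ℤ) • (Pi.single d' (1 : ℤ) : Site 2))), d)} : Set (Site 2 × Fin 2))) ∪ (({((((3 : ℤ) • b + ((1) : ℤ) • (Pi.single d (1 : ℤ) : Site 2) + ((0) : ℤ) • (Pi.single d' (1 : ℤ) : Site 2))), d'), ((((3 : ℤ) • b + ((1) : ℤ) • (Pi.single d (1 : ℤ) : Site 2) + ((-1) : ℤ) • (Pi.single d' (1 : ℤ) : Site 2))), d'), ((((3 : ℤ) • b + ((2) : ℤ) • (Pi.single d (1 : ℤ) : Site 2) + ((0) : ℤ) • (Pi.single d' (1 : ℤ) : Site 2))), d'), ((((3 : ℤ) • b + ((2) : ℤ) • (Pi.single d (1 : ℤ) : Site 2) + ((-1) : ℤ) • (Pi.single d' (1 : ℤ) : Site 2))), d')} : Set (Site 2 × Fin 2)))) := by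
  intro b d d' hd S hS
  exact Cone3.op_diff_eq_of_cylF hd hS

end Summit.CriticalPhenomena.CardyFormulaZ2.Cruxes.CriticalPathRSW.FiniteSizeEnvelope

end
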